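import Summits.BirchSwinnertonDyer.Rank1Residual.O6.JointClosure
import Literature.NumberTheory.EllipticCurves.Rank1Residual.Typed.X11Three
import HarnessLib

/-!
# The Fouquet–Wan hypothesis locus at an additive prime — E2 sub-partition predicates BY NAME and the
# CLAIM SHAPE over the interface `KMC` (cell `b2b-bsdres`, lane CLASS-CLOSURE, seat cc-typer-5; NOTHING ASSERTED)

HONEST FRAMING (cell `b2b-bsdres`, run/shared/lean/b2b/bsd-rank1-residual/, verbatim in every
file): the goal of the cell is to DELETE the COMBINATION-SHAPED residual classes of the
Birch–Swinnerton-Dyer formula for ALL analytic-rank `≤ 1` elliptic curves over `ℚ` — "full BSD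
formula for every rank `≤ 1` curve in class `C`" assembled STRICTLY from published theorems — so
that the rank-`≤ 1` remainder becomes exactly the CONSTRUCTION-SHAPED classes, which are TYPED
(missing-input `Prop`s), NOT attempted. This is not "finishing BSD". Lane CLASS-CLOSURE
(`CLASS-CLOSURE-PLAN.md` §3.4 O6 / §3.5 O5, experiment type (2) OBSTRUCTION ANATOMY → SUB-PARTITION:
"take the neighbouring proof and census EXACTLY which hypothesis fails on which pairs"): research
routes; no claim beyond the stated classes; census output is EVIDENCE, never a Literature fact;
nothing is booked; no mark of `RESIDUAL-MAP.md` moves. NO Literature fact is minted here and NO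
`_OPEN` cited Prop is registered (that register decision belongs to the lit lead + n1011 lead,
bsd-director 2026-08-21T06:13Z): this file types the HYPOTHESIS LOCUS of the neighbouring ANNOUNCED
proof as census-decidable predicates, and its conclusion as a hypothesis SHAPE over the SAME
interface `KMC` (Kato's main conjecture Conj. 12.10 at `(f_E, p)`, definition request D-O6-2, not
yet definable in the tree) that `O5/O5Targets.lean` and `O6/O6Targets.lean` use — so that "inside the
announced proof" is a NAMED sub-class of O5/O6 with kernel consequences, and "outside" is the
irreducible residue handed to ideation.

## The neighbouring announced proof (PRE — unrefereed preprint; a CLAIM, not a theorem of record)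

O. Fouquet, X. Wan, *The Iwasawa Main Conjecture for modular motives*, arXiv:2107.13726 (2021)
[FouquetWan2021]. **Theorem 5.1** (held text p0053, read), verbatim: *"Let `p ≥ 3` be a prime. Let
`f ∈ S_k(Γ₀(Np^r))` be a normalized eigencuspform with `k ≥ 2`. Assume that `ρ̄_f` satisfies the
following properties. • The `G_{ℚ,Σ}`-representation `ρ̄_f` is absolutely irreducible. • The
semisimplification of `ρ̄_f|G_{ℚ_p}` is not equal to `χ̄ ⊕ χ̄_cyc χ̄`. • There exists `ℓ ∤ p` such
that `ρ̄_f|G_{ℚ_ℓ}` is a ramified extension `0 → μχ_cyc^{1−k/2} → ρ̄|G_{ℚ_ℓ} → μχ_cyc^{−k/2} → 0`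
where `μ : G_{ℚ_ℓ} → {±1}` is an unramified character. If moreover `ρ̄_f|G_{ℚ_p}` is irreducible,
then `μ` is not trivial. If `ℓ ∥ N`, then the zeta morphism is an isomorphism
`triv_{z(f)_Iw} : Δ_{O_Iw}(T(f)_Iw) ≅ O_Iw`. Equivalently, conjecture (ConjIMC) is true."* — and
(ConjIMC) is, as displayed in the proof of Cor. 5.3 (same page), `char_{O_Iw} H²_et(ℤ[1/p], T(f)_Iw)
= char_{O_Iw} (H¹_et(ℤ[1/p], T(f)_Iw) / O_Iw·z(f)_Iw)`, i.e. Kato's Conj. 12.10 (Astérisque 295,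
p. 224) in characteristic-ideal form; Thm. 1.7 (p. 5) is the `Γ₀(N)` version. NO hypothesis on the
reduction type of `f` at `p` ("we may allow arbitrary bad reduction of `M(f)` at `p`", p. 5).

For `f = f_E`, `E/ℚ` additive at `p` (`p² ∣ N`, allowed by the level `Np^r`), weight `2`: absolute
irreducibility = `Irr W p` (`E[p]` irreducible and odd, `p` odd); the second bullet (Lgl) is IMPLIED
by `E[p]|G_{ℚ_p}` IRREDUCIBLE — typed here as `LocIrr W p` (the census's per-pair `ψ_p`-root test;
the reducible-but-(Lgl) branch is NOT typed: it needs the semisimplification characters, absent from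
the tree — AND AT `p = 3` IT IS EMPTY (o5-r1 GEN 3 (G3-1 (i)) reading, recorded by cc-typer-5 GEN 4,
doc-only): every character `G_{ℚ₃} → 𝔽₃^× = {±1}` is quadratic, so a reducible `E[3]|G_{ℚ₃}` has
semisimplification `χ̄ ⊕ χ̄·det/χ̄ = χ̄ ⊕ χ̄ χ̄_cyc` (`det ρ̄ = χ̄_cyc`, `χ̄² = 1`), i.e. (Lgl) FAILS on the whole
reducible branch; hence AT `p = 3`, FOR ELLIPTIC CURVES, (Lgl) ⟺ `LocIrr W 3` EXACTLY and `LocIrr` loses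
nothing of Fouquet–Wan's hypothesis — at `p ≥ 5` the reducible-but-(Lgl) branch is non-empty in general);
the third bullet with `ℓ ∥ N` and, on the `LocIrr` branch, `μ` non-trivial = NON-SPLIT
multiplicative reduction at some `q ≠ p` at which `E[p]` is RAMIFIED (`p ∤ v_q(Δ_min)`, Tate) — typed
as `FWNonsplitRam W p`, which IS the first conjunct of the tree's `X11.AprimeLocusAt W p` (Castella's
erratum Thm. A′ hypothesis, itself resting on Fouquet–Wan; `Typed/X11Three.lean`) and refines `Ram W p`.

CENSUS of the locus (EVIDENCE, rmap-2 gen 8, `HOME/b2b-bsdres-rmap-2/census/g8/fw_hyp_census_rmap2g8.tsv.gz`,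
`lgl3_census_rmap2g8.{md,tsv.gz}`; INBOX 2026-08-21T06:06Z/06:08Z/06:11Z; cells of book196 X4):
O5 ∩ X4 at `p ≥ 5`, `r = 0`, `surj ∧ Stb` (LocIrr automatic at a tame potentially supersingular
`p ≥ 5`): `(G) ∧ ss` 541 / 739, `(t′)` 3 193 / 4 899; at `p = 3`, `surj ∧ Stb(non-split) ∧ LocIrr`:
`(t′)` r0 3 120 / 10 158 (LocIrr on 5 481), (w) r0 2 102 / 21 314 (LocIrr on 3 617); r1: `(t′)` 558 /
1 756, (w) 622 / 5 348. So the announced proof reaches ≈ 31 % of the tame and ≈ 10 % of the wild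
potentially supersingular X4 cells at `3`; the rest FAIL `LocIrr` (`E[3]|G_{ℚ₃}` reducible — the common
case at a wild `3`) or `Stb`. SECOND SOURCE at `p ≥ 5` (n1011-p14 gen 2, independent engine, INBOX
2026-08-21T06:18Z): universes identical (23 673 X4 pairs), per-pair cell / (Stb) / (Lgl): 0
disagreements; `(G) ∧ ss` r0 541 / 739, `(t′)` r0 3 193 / 4 899 reproduced exactly.

Contents: §1 the two predicates and their links (`FWNonsplitRam.ram`, `fwNonsplitRam_of_aprimeLocusAt`);
§2 `FouquetWanClaimShape KMC` (hypothesis shape; consumed only explicitly); §3 kernel consequences on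
O5/O6 at `p = 3`: inside the locus, FW's claim + the shared descent shell
(`O5.PotSupersingularLowerHalfRankZeroOfKMC`) give the r0 LOWER half, hence `MissingPPartAt W 3` with
Kato's upper half (gen 0), and the rank-one member via `O6.missingPPartAt_three_rankOne_of_heegnerIndexBSDAt_of_shared`.
-/

noncomputable section

open scoped Classical

open WeierstrassCurve Literature.NumberTheory.EllipticCurves
  Literature.NumberTheory.EllipticCurves.ModularForms
  Literature.NumberTheory.EllipticCurves.Rank1Residual
  Literature.NumberTheory.EllipticCurves.Rank1Residual.Typed

namespace Summit.BirchSwinnertonDyer.Rank1Residual.Additive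

/-! ## §1 The hypothesis locus, by name -/

section Locus

variable (W : WeierstrassCurve ℚ) [W.IsGloballyMinimal] (p : ℕ) [Fact p.Prime]

/-- **(Stb), non-split form**: there is a prime `q ≠ p` of NON-SPLIT multiplicative reduction at which
`E[p]` is ramified (`p ∤ v_q(Δ_min)`, Tate's parametrisation) — Fouquet–Wan Thm. 5.1, third bullet
with "`μ` not trivial" and `ℓ ∥ N`, for `f = f_E`. Literally the first conjunct of the tree's
`X11.AprimeLocusAt W p` (Castella 2018 erratum, Thm. A′). A census-decidable predicate (Cremona:
reduction type at `q ∥ N` + `v_q(Δ)` mod `p`); nothing asserted.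
[cite: FouquetWan2021, Thm. 5.1 (third hypothesis) and Thm. 1.7 (p. 5)] [cite: Castella2018Erratum, Thm. A′ (p. 1), hypotheses] -/
def FWNonsplitRam : Prop :=
  ∃ (q : ℕ) (_ : Fact q.Prime), q ≠ p ∧ W.HasMultiplicativeReductionAtPrime q ∧
    ¬ W.HasSplitMultiplicativeReductionAtPrime q ∧ ¬ p ∣ padicValInt q W.minimalDiscriminantInt

/-- **(Lgl), sufficient form**: `E[p]` is IRREDUCIBLE as a `G_{ℚ_p}`-module (the mod-`p`
representation of the base change `E/ℚ_p`). Implies Fouquet–Wan's second bullet ("the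
semisimplification of `ρ̄|G_{ℚ_p}` is not `χ̄ ⊕ χ̄_cyc χ̄`") and triggers the "`μ` not trivial" clause of
the third; at `p = 3` it is EQUIVALENT to the second bullet for elliptic curves (characters of `G_{ℚ₃}`
into `𝔽₃^×` are quadratic — module docstring). Census: the `ψ_p`-root test over `ℚ_p` (rmap-2 g8 `lgl3_census`). A predicate; nothing
asserted. [cite: FouquetWan2021, Thm. 5.1 (second hypothesis and the clause "if ρ̄_f|G_{ℚ_p} is irreducible")] -/
def LocIrr : Prop :=
  (W.baseChange ℚ_[p]).HasIrreducibleModPGaloisRep p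

omit [Fact p.Prime] in
/-- The non-split ramified locus refines the cell's `Ram` (Skinner–Urban's (ram)). [folklore] -/
theorem FWNonsplitRam.ram [Fact p.Prime] (h : FWNonsplitRam W p) : Ram W p := by
  obtain ⟨q, hq, hqp, hmult, _, hv⟩ := h
  exact ⟨q, hq, hqp, hmult, hv⟩

/-- Castella's A′-locus contains the non-split ramified condition (its first conjunct).
[cite: Castella2018Erratum, Thm. A′ (p. 1), hypotheses] -/
theorem fwNonsplitRam_of_aprimeLocusAt (h : X11.AprimeLocusAt W p) : FWNonsplitRam W p := h.1

end Locus

/-! ## §2 The CLAIM SHAPE over the interface `KMC` (announced, PRE; consumed only as an explicit hypothesis) -/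

section Claim

variable (KMC : ∀ (W : WeierstrassCurve ℚ) [W.IsElliptic] [W.IsGloballyMinimal] (p : ℕ), Prop)

/-- **SHAPE of Fouquet–Wan Thm. 5.1 / 1.7 for `f = f_E` at an ODD prime `p` on the `LocIrr` branch**:
for `E/ℚ` with `E[p]` (absolutely) irreducible — here through `ClassX4 W p` (`p ≠ 2 ∧ Addv ∧ Irr`;
the additive classes are this file's business, the level `Np^r` of Thm. 5.1 allowing `p² ∣ N_E`) —,
`E[p]|G_{ℚ_p}` irreducible and a non-split multiplicative `q ≠ p` with `E[p]` ramified at `q`: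
Kato's main conjecture `KMC W p`. A hypothesis SHAPE over the interface (the statement `KMC` is the
undefined D-O6-2; the source is an unrefereed preprint): NOT a theorem of record, NOT a Literature
fact, consumed below only as an explicit hypothesis `(hFW : FouquetWanClaimShape KMC)`.
[cite: FouquetWan2021, Thm. 5.1 and Thm. 1.7 (p. 5)] [cite: Kato2004Asterisque, Conj. 12.10 (p. 224)] -/
def FouquetWanClaimShape : Prop :=
  ∀ (W : WeierstrassCurve ℚ) [W.IsElliptic] [W.IsGloballyMinimal] (p : ℕ) [Fact p.Prime],
    ClassX4 W p → LocIrr W p → FWNonsplitRam W p → KMC W p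

end Claim

/-! ## §3 Kernel consequences on O5 / O6 at `p = 3` (everything conjectural or announced is a hypothesis) -/

section Consequences

variable (KMC : ∀ (W : WeierstrassCurve ℚ) [W.IsElliptic] [W.IsGloballyMinimal] (p : ℕ), Prop)

/-- **Inside the FW locus, the shared descent shell gives the r0 LOWER half.** For an O5/O6 pair at
`3` on X4 with `E[3]|G_{ℚ₃}` irreducible, a non-split ramified `q`, Kato's (12.5.2), `L(E,1) ≠ 0`
and `Ш` finite: `FouquetWanClaimShape KMC` (announced) + `O5.PotSupersingularLowerHalfRankZeroOfKMC
KMC` (conjecture shell, T-O5-A (d1) = T-O6-A (A0)) ⇒ `MissingLowerBoundAt W 3`. Nothing credited.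
[cite: FouquetWan2021, Thm. 5.1] [cite: Kato2004Asterisque, Conj. 12.10 (p. 224)] -/
theorem missingLowerBoundAt_three_of_fwClaim_of_shared (hFW : FouquetWanClaimShape KMC)
    (hshared : O5.PotSupersingularLowerHalfRankZeroOfKMC KMC)
    (W : WeierstrassCurve ℚ) [W.IsElliptic] [W.IsGloballyMinimal]
    (hO : ClassO5 W 3 ∨ ClassO6 W 3) (hX : ClassX4 W 3) (hirr : LocIrr W 3)
    (hstb : FWNonsplitRam W 3) (himg : Kato2004.ImageContainsSL2 W 3)
    (hL : W.entireLFunction 1 ≠ 0) (hfin : Finite W.sha) : MissingLowerBoundAt W 3 :=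
  hshared W hO himg (hFW W 3 hX hirr hstb) hL hfin

/-- **Inside the FW locus, rank `0`: the `3`-part in Miller's currency**, from the announced claim +
the shared shell (lower half) + Kato Thm. 14.5 (3) (upper half, PUBLISHED, `hKato`) on
`X4 ∧ (O5 ∨ O6) ∧ r0 ∧ towerSurj ∧ 3 ∤ ∏ c_ℓ ∧ 3 ∤ c_D` — gen 0's
`ClassO5/ClassO6.missingPPartAt_iff_lower_of_kato`. This is the "verbatim-extension modulo refereeing
+ the descent (d1)" sub-class of O5/O6 named for provers; its complement (¬LocIrr ∨ ¬Stb) is the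
residue for ideation. [cite: FouquetWan2021, Thm. 5.1] [cite: Kato2004Asterisque, Thm. 14.5 (3) (p. 236)]
[cite: Miller2011LMS, Def. 1.1] -/
theorem missingPPartAt_three_rankZero_of_fwClaim_of_shared_of_kato (hFW : FouquetWanClaimShape KMC)
    (hshared : O5.PotSupersingularLowerHalfRankZeroOfKMC KMC)
    (hKato : Kato2004.rankZero_padicValNat_sha_le_of_additive_potGood_of_imageContainsSL2)
    (hGZK : rank_eq_analyticRank_of_analyticRank_le_one) (hmod : hasEntireLFunction_rat)
    (W : WeierstrassCurve ℚ) [W.IsElliptic] [W.IsGloballyMinimal]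
    (hr : W.analyticRank = 0) (hO : ClassO5 W 3 ∨ ClassO6 W 3) (hX : ClassX4 W 3)
    (hirr : LocIrr W 3) (hstb : FWNonsplitRam W 3)
    (hsurj : ∀ n : ℕ, W.HasSurjectiveModNGaloisRep (3 ^ n : ℕ)) (htam : ¬ 3 ∣ W.tamagawaProduct)
    {N : ℕ} [NeZero N] (D : ModularParametrizationData W N) (hc : ¬ (3 : ℤ) ∣ D.maninConstant) :
    MissingPPartAt W 3 := by
  have himg : Kato2004.ImageContainsSL2 W 3 :=
    (Kato2004.imageContainsSL2_iff_forall_hasSurjectiveModNGaloisRep W 3).mpr hsurj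
  have hL : W.entireLFunction 1 ≠ 0 := (W.analyticRank_eq_zero_iff_holds (hmod W)).mp hr
  have hfin : Finite W.sha := (hGZK W (hr.le.trans zero_le_one)).2
  have hlow := missingLowerBoundAt_three_of_fwClaim_of_shared KMC hFW hshared W hO hX hirr hstb himg
    hL hfin
  rcases hO with h5 | h6
  · exact (ClassO5.missingPPartAt_iff_lower_of_kato W 3 hKato hGZK hmod hr h5 hX hsurj htam D hc).mpr
      hlow
  · exact (ClassO6.missingPPartAt_iff_lower_of_kato W 3 hKato hGZK hmod hr h6 hX hsurj htam D hc).mpr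
      hlow

/-- **Inside the FW locus AT THE TWIST, rank `1`**: for a rank-one O5/O6 X4 curve `W` whose Heegner
twist `Wd` (rank `0`, again O5/O6, X4, tower-surjective, `3 ∤ ∏ c_ℓ(Wd) · c_{Dd}`) lies in the FW
locus (`LocIrr Wd 3`, `FWNonsplitRam Wd 3` — NOT automatic from `W`: an unramified quadratic twist can
exchange split and non-split at `q`), the announced claim + the shared shell + Gross's Conjecture 1.2
at the pair (`O5.HeegnerIndexBSDAt W 3`, T-O5-B / T-O6-C) + Kato + STEP-0 give `MissingPPartAt W 3`
(`O6.missingPPartAt_three_rankOne_of_heegnerIndexBSDAt_of_shared`). Nothing credited.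
[cite: FouquetWan2021, Thm. 5.1] [cite: GrossLMS1991, §1 Conj. 1.2 (p. 237)] [cite: Miller2011LMS, Def. 1.1] -/
theorem missingPPartAt_three_rankOne_of_fwClaim_at_twist (hFW : FouquetWanClaimShape KMC)
    (hshared : O5.PotSupersingularLowerHalfRankZeroOfKMC KMC)
    (hKato : Kato2004.rankZero_padicValNat_sha_le_of_additive_potGood_of_imageContainsSL2)
    (hGZK : rank_eq_analyticRank_of_analyticRank_le_one) (hmod : hasEntireLFunction_rat)
    (W : WeierstrassCurve ℚ) [W.IsElliptic] [W.IsGloballyMinimal] (hr : W.analyticRank ≤ 1)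
    (hHI : O5.HeegnerIndexBSDAt W 3) (hρ : W.HasSurjectiveModNGaloisRep 3)
    {N : ℕ} [NeZero N] (D : ModularParametrizationData W N)
    (K : Type) [Field K] [NumberField K] (hK : IsImaginaryQuadratic K)
    (hH : SatisfiesHeegnerHypothesis N K) (hdK : NumberField.discr K < -4)
    (H : HeegnerDatum N (NumberField.discr K)) (ι : K →+* ℂ) {P : (W.baseChange K).toAffine.Point}
    (hP : WeierstrassCurve.Affine.Point.map ι.toRatAlgHom P = heegnerPointComplex D H)
    (hnt : ¬ IsOfFinAddOrder P)
    (Wd : WeierstrassCurve ℚ) [Wd.IsElliptic] [Wd.IsGloballyMinimal]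
    (hWd : ∃ C : VariableChange ℚ, C • W.quadraticTwist (NumberField.discr K : ℚ) = Wd)
    (hrD : Wd.analyticRank = 0) (hOd : ClassO5 Wd 3 ∨ ClassO6 Wd 3) (hXd : ClassX4 Wd 3)
    (hirrd : LocIrr Wd 3) (hstbd : FWNonsplitRam Wd 3)
    (htowerd : ∀ n : ℕ, Wd.HasSurjectiveModNGaloisRep (3 ^ n : ℕ))
    (htamd : ¬ 3 ∣ Wd.tamagawaProduct)
    {Nd : ℕ} [NeZero Nd] (Dd : ModularParametrizationData Wd Nd) (hcd : ¬ (3 : ℤ) ∣ Dd.maninConstant)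
    {q₀ q₁ : ℚ} (hq₀ : shaAn W = (q₀ : ℂ)) (hq₁ : shaAn Wd = (q₁ : ℂ))
    (hstep0 : padicValRat 3 q₀ + padicValRat 3 q₁ + ((2 * padicValNat 3 W.tamagawaProduct : ℕ) : ℤ) +
        ((2 * padicValInt 3 D.maninConstant : ℕ) : ℤ) =
      ((2 * padicValNat 3 (AddSubgroup.zmultiples P).index : ℕ) : ℤ)) :
    MissingPPartAt W 3 :=
  O6.missingPPartAt_three_rankOne_of_heegnerIndexBSDAt_of_shared KMC hshared hKato hGZK hmod W hr hHI
    hρ D K hK hH hdK H ι hP hnt Wd hWd hrD hOd hXd htowerd htamd Dd hcd (hFW Wd 3 hXd hirrd hstbd) hq₀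
    hq₁ hstep0

end Consequences

end Summit.BirchSwinnertonDyer.Rank1Residual.Additive

end
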